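import Literature.Geometry.Lorentzian.CoordTensorCovariance
import HarnessLib

/-!
# Naturality of the coordinate Ricci form under changes of coordinates

A complement to `CoordTensorCovariance.lean` (naturality of the curvature endomorphism,
`MetricCoord.IsMetricOn.fderiv_riemAt_pullMetric`, O'Neill 1983, Ch. 3, Prop. 3.59 (2)): the trace
is natural as well. For metric components `G` on `V`, a change of coordinates `ψ : V' → V`
(`MetricCoord.IsCoordChangeOn`) and the pulled-back components `pullMetric G ψ`,

* `IsMetricOn.ricAt_pullMetric` — **`Ric(ψ^*G)_y(Y, Z) = Ric(G)_{ψ y}(Dψ_y Y, Dψ_y Z)`**;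
* `IsMetricOn.ricAt_pullMetric_eq_bilinearComp` — the same as an identity of bilinear forms,
  `Ric(ψ^*G)_y = Ric(G)_{ψ y} ∘ (Dψ_y × Dψ_y)`;
* `IsMetricOn.ricAt_pullMetric_eq_zero` — in particular Ricci-flatness is preserved by changes of
  coordinates.

Proof: on a basis `b` the curvature endomorphisms are conjugate under `Dψ_y`
(`fderiv_riemAt_pullMetric`), so their traces agree (`ricAt_eq_sum_coord` in the bases `b` and
`Dψ_y b`); then extend bilinearly. Everything is proved; no definition.

## References

* B. O'Neill, *Semi-Riemannian geometry with applications to relativity*, Academic Press 1983,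
  Ch. 3, Prop. 3.59–Cor. 3.61, Lemma 3.52. [ONeill1983]
-/

noncomputable section

set_option maxSynthPendingDepth 3

open Set Function ContinuousLinearMap Module

namespace Literature.Geometry.Lorentzian

namespace MetricCoord

variable {E : Type*} [NormedAddCommGroup E] [NormedSpace ℝ E] [FiniteDimensional ℝ E]
  [CompleteSpace E] {G : E → E →L[ℝ] E →L[ℝ] ℝ} {ψ : E → E} {V V' : Set E} {y : E}

/-- **The coordinate Ricci form is natural under changes of coordinates**:
`Ric(ψ^*G)_y(Y, Z) = Ric(G)_{ψ y}(Dψ_y Y, Dψ_y Z)` on `V'` (O'Neill 1983, Ch. 3, Prop. 3.59 (2),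
traced: conjugate endomorphisms have equal traces). [cite: ONeill1983, Ch. 3, Prop. 3.59] -/
theorem IsMetricOn.ricAt_pullMetric (hG : IsMetricOn G V) (hψ : IsCoordChangeOn ψ V' V)
    (hy : y ∈ V') (Y Z : E) :
    ricAt (pullMetric G ψ) y Y Z = ricAt G (ψ y) (fderiv ℝ ψ y Y) (fderiv ℝ ψ y Z) := by
  obtain ⟨e, he⟩ := hψ.isInvertible y hy
  set b := Module.finBasis ℝ E with hb
  -- on basis vectors: both sides are `Σ_j b^j (e⁻¹ R(e b_j, Dψ b_k) Dψ b_i)`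
  have hbasis : ∀ k i, ricAt (pullMetric G ψ) y (b k) (b i) =
      ricAt G (ψ y) (fderiv ℝ ψ y (b k)) (fderiv ℝ ψ y (b i)) := by
    intro k i
    rw [ricAt_eq_sum_coord b, ricAt_eq_sum_coord (b.map e.toLinearEquiv)]
    refine Finset.sum_congr rfl fun j _ ↦ ?_
    have hR := hG.fderiv_riemAt_pullMetric (b := b) hψ hy j k i
    have h2 : riemAt (pullMetric G ψ) y (b j) (b k) (b i) =
        e.symm (riemAt G (ψ y) (fderiv ℝ ψ y (b j)) (fderiv ℝ ψ y (b k))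
          (fderiv ℝ ψ y (b i))) := by
      rw [← hR, ← he]
      exact (e.symm_apply_apply _).symm
    rw [h2, Module.Basis.coord_apply, Module.Basis.coord_apply, Module.Basis.map_repr,
      LinearEquiv.trans_apply, Module.Basis.map_apply, ← he]
    rfl
  -- extend bilinearly
  have hext : ricAt (pullMetric G ψ) y =
      (ricAt G (ψ y)).bilinearComp (fderiv ℝ ψ y) (fderiv ℝ ψ y) := by
    refine ContinuousLinearMap.coe_injective (b.ext fun k ↦ ?_)
    refine ContinuousLinearMap.coe_injective (b.ext fun i ↦ ?_)
    simp only [ContinuousLinearMap.coe_coe, ContinuousLinearMap.bilinearComp_apply]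
    exact hbasis k i
  rw [hext, ContinuousLinearMap.bilinearComp_apply]

/-- The same as an identity of bilinear forms: `Ric(ψ^*G)_y = Ric(G)_{ψ y} ∘ (Dψ_y × Dψ_y)`.
[cite: ONeill1983, Ch. 3, Prop. 3.59] -/
theorem IsMetricOn.ricAt_pullMetric_eq_bilinearComp (hG : IsMetricOn G V)
    (hψ : IsCoordChangeOn ψ V' V) (hy : y ∈ V') :
    ricAt (pullMetric G ψ) y = (ricAt G (ψ y)).bilinearComp (fderiv ℝ ψ y) (fderiv ℝ ψ y) := by
  ext Y Z
  rw [hG.ricAt_pullMetric hψ hy, ContinuousLinearMap.bilinearComp_apply]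

/-- **Ricci-flatness is preserved by changes of coordinates**: if `Ric(G) = 0` at `ψ y` then
`Ric(ψ^*G) = 0` at `y`. [cite: ONeill1983, Ch. 3, Cor. 3.61] -/
theorem IsMetricOn.ricAt_pullMetric_eq_zero (hG : IsMetricOn G V) (hψ : IsCoordChangeOn ψ V' V)
    (hy : y ∈ V') (h0 : ricAt G (ψ y) = 0) : ricAt (pullMetric G ψ) y = 0 := by
  rw [hG.ricAt_pullMetric_eq_bilinearComp hψ hy, h0]
  ext Y Z
  simp

end MetricCoord

end Literature.Geometry.Lorentzian

end

/-! ### Naturality of the quadratic and cubic trace invariants of the curvature (appended 2026-08-16)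

Complementing `ricAt_pullMetric`: for metric components `G` on `V`, a change of coordinates
`ψ : V' → V` and `ψ^*G = pullMetric G ψ`, at `y ∈ V'` with `D = Dψ_y`, the inverse metric
coefficients of `ψ^*G` in a basis `b` are those of `G` in the basis `D b` at `ψ y`
(`ginv_pullMetric`); the curvature endomorphisms are conjugate (`riemAt_pullMetric_eq_conj`, the
endomorphism form of `IsMetricOn.fderiv_riemAt_pullMetric`); hence the full contractions
`Σ g^{aa'}g^{cc'} tr(R(b_a,b_c)R(b_{a'},b_{c'}))` (`= −|Rm|²`, `rmNormSqAt_eq_sum`) and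
`Σ g^{aa'}g^{cc'}g^{ee'} tr(R(b_a,b_c)R(b_{c'},b_e)R(b_{e'},b_{a'}))` are natural in ANY signature
(`quadTrace_pullMetric`, `cubicTrace_pullMetric`, `rmNormSqAt_pullMetric`; O'Neill 1983, Ch. 3,
Prop. 3.59: local isometries preserve the curvature tensor and all its metric contractions).
Everything is proved; no definition. -/

noncomputable section

namespace Literature.Geometry.Lorentzian

namespace MetricCoord

section TraceInvariantNaturality

set_option maxSynthPendingDepth 3

open Set Function ContinuousLinearMap Module

variable {E : Type*} [NormedAddCommGroup E] [NormedSpace ℝ E] [FiniteDimensional ℝ E]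
  [CompleteSpace E] {G : E → E →L[ℝ] E →L[ℝ] ℝ} {ψ : E → E} {V V' : Set E} {y : E}
  {ι : Type*} [Fintype ι] [DecidableEq ι] (b : Module.Basis ι ℝ E)

omit [CompleteSpace E] in
/-- The inverse metric coefficients in a basis form a left inverse of the transposed Gram matrix:
`Σ_j g^{ij} G(b_k, b_j) = δ_{ik}` (`coord_eq_sum_ginv` on basis vectors).
[cite: ONeill1983, Ch. 3, p. 60] -/
theorem sum_ginv_mul_apply_basis {x : E} (hx : (G x).IsInvertible) (i k : ι) :
    ∑ j, ginv G b x i j * G x (b k) (b j) = if i = k then 1 else 0 := by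
  rw [← coord_eq_sum_ginv b hx (b k) i, Module.Basis.coord_apply, Module.Basis.repr_self,
    Finsupp.single_apply]
  simp only [eq_comm]

omit [CompleteSpace E] in
/-- **The inverse metric coefficients are determined by the Gram matrix**: if two invertible
symmetric forms have the same Gram matrices in bases `b`, `b'` (`G x (b k) (b j) = G' x' (b' k) (b' j)`),
their inverse coefficients agree. [cite: ONeill1983, Ch. 3, Lemma 3.4] -/
theorem ginv_eq_of_gram_eq {G' : E → E →L[ℝ] E →L[ℝ] ℝ} {x x' : E} {b' : Module.Basis ι ℝ E}
    (hx : (G x).IsInvertible) (hx' : (G' x').IsInvertible)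
    (h : ∀ k j, G x (b k) (b j) = G' x' (b' k) (b' j)) (i j : ι) :
    ginv G b x i j = ginv G' b' x' i j := by
  -- both coefficient matrices are left inverses of the same matrix
  have h1 : (Matrix.of fun i j ↦ ginv G b x i j) * (Matrix.of fun j k ↦ G x (b k) (b j)) = 1 := by
    ext i k
    rw [Matrix.mul_apply, Matrix.one_apply]
    simp only [Matrix.of_apply]
    exact sum_ginv_mul_apply_basis b hx i k
  have h2 : (Matrix.of fun i j ↦ ginv G' b' x' i j) * (Matrix.of fun j k ↦ G x (b k) (b j)) = 1 := by
    ext i k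
    rw [Matrix.mul_apply, Matrix.one_apply]
    simp only [Matrix.of_apply, h]
    exact sum_ginv_mul_apply_basis b' hx' i k
  have := Matrix.left_inv_eq_left_inv h1 h2
  have hij := congrFun (congrFun this i) j
  simpa using hij

omit [CompleteSpace E] in
/-- **The inverse metric of the pulled-back components**: `g'^{ij}` of `ψ^*G` at `y` in the basis
`b` equals `g^{ij}` of `G` at `ψ y` in the basis `Dψ_y b`. [cite: ONeill1983, Ch. 3, Prop. 3.59] -/
theorem ginv_pullMetric (hG : IsMetricOn G V) (hψ : IsCoordChangeOn ψ V' V) (hy : y ∈ V')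
    {D : E ≃L[ℝ] E} (hD : (D : E →L[ℝ] E) = fderiv ℝ ψ y) (i j : ι) :
    ginv (pullMetric G ψ) b y i j = ginv G (b.map D.toLinearEquiv) (ψ y) i j := by
  refine ginv_eq_of_gram_eq b ((hG.isMetricOn_pullMetric hψ).isInvertible y hy)
    (hG.isInvertible _ (hψ.mapsTo hy)) (fun k l ↦ ?_) i j
  rw [pullMetric_apply, Module.Basis.map_apply, Module.Basis.map_apply, ← hD]
  rfl

/-- **The curvature endomorphisms of `ψ^*G` are the conjugates of those of `G`**:
`R'(b_j, b_k) = D⁻¹ ∘ R(D b_j, D b_k) ∘ D`, `D = Dψ_y` (`fderiv_riemAt_pullMetric`).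
[cite: ONeill1983, Ch. 3, Prop. 3.59] -/
theorem riemAt_pullMetric_eq_conj (hG : IsMetricOn G V) (hψ : IsCoordChangeOn ψ V' V) (hy : y ∈ V')
    {D : E ≃L[ℝ] E} (hD : (D : E →L[ℝ] E) = fderiv ℝ ψ y) (j k : ι) :
    riemAt (pullMetric G ψ) y (b j) (b k) =
      ((D.symm : E →L[ℝ] E).comp (riemAt G (ψ y) (D (b j)) (D (b k)))).comp (D : E →L[ℝ] E) := by
  refine ContinuousLinearMap.coe_injective (b.ext fun i ↦ ?_)
  simp only [ContinuousLinearMap.coe_coe, ContinuousLinearMap.comp_apply]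
  have h := hG.fderiv_riemAt_pullMetric (b := b) hψ hy j k i
  rw [← hD] at h
  simp only [ContinuousLinearEquiv.coe_coe] at h
  change _ = D.symm (riemAt G (ψ y) (D (b j)) (D (b k)) (D (b i)))
  rw [← h]
  exact (D.symm_apply_apply _).symm

omit [CompleteSpace E] in
/-- `tr(D⁻¹ X D) = tr X` for a continuous linear automorphism `D`. [folklore] -/
theorem traceCLM_conj (D : E ≃L[ℝ] E) (X : E →L[ℝ] E) :
    traceCLM E (((D.symm : E →L[ℝ] E).comp X).comp (D : E →L[ℝ] E)) = traceCLM E X := by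
  rw [traceCLM_apply, traceCLM_apply]
  have h1 : ((((D.symm : E →L[ℝ] E).comp X).comp (D : E →L[ℝ] E) : E →L[ℝ] E) : E →ₗ[ℝ] E) =
      ((D.symm : E →L[ℝ] E) : E →ₗ[ℝ] E) ∘ₗ ((X.comp (D : E →L[ℝ] E) : E →L[ℝ] E) : E →ₗ[ℝ] E) :=
    rfl
  have h2 : ((X.comp (D : E →L[ℝ] E) : E →L[ℝ] E) : E →ₗ[ℝ] E) ∘ₗ
      ((D.symm : E →L[ℝ] E) : E →ₗ[ℝ] E) = (X : E →ₗ[ℝ] E) := by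
    ext v
    simp
  rw [h1, LinearMap.trace_comp_comm', h2]

omit [FiniteDimensional ℝ E] [CompleteSpace E] in
/-- Products of conjugates are conjugates of products. [folklore] -/
theorem conj_comp_conj (D : E ≃L[ℝ] E) (X Y : E →L[ℝ] E) :
    ((((D.symm : E →L[ℝ] E).comp X).comp (D : E →L[ℝ] E))).comp
        (((D.symm : E →L[ℝ] E).comp Y).comp (D : E →L[ℝ] E)) =
      ((D.symm : E →L[ℝ] E).comp (X.comp Y)).comp (D : E →L[ℝ] E) := by
  ext v
  simp

/-- **Naturality of the quadratic trace invariant** `Σ g^{aa'} g^{cc'} tr(R(b_a,b_c) R(b_{a'},b_{c'}))`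
(`= −|Rm|²_G`, `rmNormSqAt_eq_sum`): its value for `ψ^*G` at `y` in the basis `b` is its value for
`G` at `ψ y` in the basis `Dψ_y b`. [cite: ONeill1983, Ch. 3, Prop. 3.59] -/
theorem quadTrace_pullMetric (hG : IsMetricOn G V) (hψ : IsCoordChangeOn ψ V' V) (hy : y ∈ V')
    {D : E ≃L[ℝ] E} (hD : (D : E →L[ℝ] E) = fderiv ℝ ψ y) :
    ∑ a, ∑ a', ∑ c, ∑ c', ginv (pullMetric G ψ) b y a a' * ginv (pullMetric G ψ) b y c c' *
        traceCLM E ((riemAt (pullMetric G ψ) y (b a) (b c)).comp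
          (riemAt (pullMetric G ψ) y (b a') (b c'))) =
      ∑ a, ∑ a', ∑ c, ∑ c', ginv G (b.map D.toLinearEquiv) (ψ y) a a' *
        ginv G (b.map D.toLinearEquiv) (ψ y) c c' *
        traceCLM E ((riemAt G (ψ y) (b.map D.toLinearEquiv a) (b.map D.toLinearEquiv c)).comp
          (riemAt G (ψ y) (b.map D.toLinearEquiv a') (b.map D.toLinearEquiv c'))) := by
  refine Finset.sum_congr rfl fun a _ ↦ Finset.sum_congr rfl fun a' _ ↦
    Finset.sum_congr rfl fun c _ ↦ Finset.sum_congr rfl fun c' _ ↦ ?_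
  rw [ginv_pullMetric b hG hψ hy hD, ginv_pullMetric b hG hψ hy hD,
    riemAt_pullMetric_eq_conj b hG hψ hy hD, riemAt_pullMetric_eq_conj b hG hψ hy hD,
    conj_comp_conj, traceCLM_conj]
  simp only [Module.Basis.map_apply]
  rfl

/-- **Naturality of the cubic trace invariant**
`Σ g^{aa'} g^{cc'} g^{ee'} tr(R(b_a,b_c) R(b_{c'},b_e) R(b_{e'},b_{a'}))`: its value for `ψ^*G` at
`y` in the basis `b` is its value for `G` at `ψ y` in the basis `Dψ_y b`.
[cite: ONeill1983, Ch. 3, Prop. 3.59] -/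
theorem cubicTrace_pullMetric (hG : IsMetricOn G V) (hψ : IsCoordChangeOn ψ V' V) (hy : y ∈ V')
    {D : E ≃L[ℝ] E} (hD : (D : E →L[ℝ] E) = fderiv ℝ ψ y) :
    ∑ a, ∑ a', ∑ c, ∑ c', ∑ e, ∑ e',
        ginv (pullMetric G ψ) b y a a' * ginv (pullMetric G ψ) b y c c' *
        ginv (pullMetric G ψ) b y e e' *
        traceCLM E ((riemAt (pullMetric G ψ) y (b a) (b c)).comp
          ((riemAt (pullMetric G ψ) y (b c') (b e)).comp
            (riemAt (pullMetric G ψ) y (b e') (b a')))) =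
      ∑ a, ∑ a', ∑ c, ∑ c', ∑ e, ∑ e',
        ginv G (b.map D.toLinearEquiv) (ψ y) a a' * ginv G (b.map D.toLinearEquiv) (ψ y) c c' *
        ginv G (b.map D.toLinearEquiv) (ψ y) e e' *
        traceCLM E ((riemAt G (ψ y) (b.map D.toLinearEquiv a) (b.map D.toLinearEquiv c)).comp
          ((riemAt G (ψ y) (b.map D.toLinearEquiv c') (b.map D.toLinearEquiv e)).comp
            (riemAt G (ψ y) (b.map D.toLinearEquiv e') (b.map D.toLinearEquiv a')))) := by
  refine Finset.sum_congr rfl fun a _ ↦ Finset.sum_congr rfl fun a' _ ↦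
    Finset.sum_congr rfl fun c _ ↦ Finset.sum_congr rfl fun c' _ ↦
    Finset.sum_congr rfl fun e _ ↦ Finset.sum_congr rfl fun e' _ ↦ ?_
  rw [ginv_pullMetric b hG hψ hy hD, ginv_pullMetric b hG hψ hy hD, ginv_pullMetric b hG hψ hy hD,
    riemAt_pullMetric_eq_conj b hG hψ hy hD, riemAt_pullMetric_eq_conj b hG hψ hy hD,
    riemAt_pullMetric_eq_conj b hG hψ hy hD, conj_comp_conj, conj_comp_conj, traceCLM_conj]
  simp only [Module.Basis.map_apply]
  rfl

/-- **`|Rm|²` is natural under changes of coordinates** (any signature):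
`|Rm(ψ^*G)|²(y) = |Rm(G)|²(ψ y)`. [cite: ONeill1983, Ch. 3, Prop. 3.59] -/
theorem rmNormSqAt_pullMetric (hG : IsMetricOn G V) (hψ : IsCoordChangeOn ψ V' V) (hy : y ∈ V') :
    rmNormSqAt (pullMetric G ψ) y = rmNormSqAt G (ψ y) := by
  obtain ⟨D, hD⟩ := hψ.isInvertible y hy
  set b₀ := Module.finBasis ℝ E
  rw [rmNormSqAt_eq_sum b₀, rmNormSqAt_eq_sum (b₀.map D.toLinearEquiv),
    quadTrace_pullMetric b₀ hG hψ hy hD]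


end TraceInvariantNaturality

end MetricCoord

end Literature.Geometry.Lorentzian

end
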